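import Literature.Probability.FitznerVanDerHofstad2017.NobleElementsClosedForms
import Literature.Probability.FitznerVanDerHofstad2017.NoblePercLetters
import HarnessLib

/-!
# The double-open triangle with the §6.1-typed (repulsive) row `(0,2)` — an ADDITIVE family `Ā''`

[FvdH17] §6.1 "Bound in terms of diagrams: N ≥ 1", **Case `a = 0, b ≥ 2`** (arXiv:1506.07977v2 p. 59,
l.9918–9922 of the source): "We note that `u = w ≠ t, z` and obtain
`𝓣_{1,1̲,0}(u−z, u+e_ι−z, t−z) ≤ Ā^{ι,0,2}(u,u,z,t)`" — the object the proof produces at entry `(ι,0,2)` of the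
UN-starred `Ā^ι` is the REPULSIVE triangle `𝓣_{1,1̲,0}` (this §6.1 locus carries the definition below);
corroborating only, per the literature seat's extraction (programme note GAPS l.1074; not re-extracted by the
referee, gen 201): [Fit13] (4.5.18) p. 206 displays `Ā^{ι,0,2}(0,v,x,y) = δ_{0,v} 𝓣_{1,1̲,0}(−y, e_ι−y, x−y)`
without a star.  The isolated App. B display (B.5c)
(p. 78, l.10596–10598) `Ā^{ι,0,2}(0,v,x,y) = δ_{0,v} 𝓣*_{1,1̲,0}(−y, e_ι−y, x−y)` — the row the landed
`NobleBlocks.blockAbar₀` types — is the displayed weakening `𝓣 ≤ 𝓣*` ((4.14)–(4.15); in the tree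
`perc_T_le_Tst`).  This module does NOT edit any landed declaration: on the precedent of
`NobleBlocksPrime.blockAbar₀'` (row `(0,0)` from §6.1) it adds the family

* `blockAbar₀'' L ι a b := if a = 0 ∧ b = 2 then δ_{v,0} · L.T (≥1) (=1̲) (≥0) (−y) (e_ι−y) (x−y) else blockAbar₀' L ι a b`,
  `blockAbar'' := ofBase (blockAbar₀'' …)`, `matAbarIota'' L := matAbar (blockAbar'' L)`;
* agreement off `(0,2)` (`blockAbar₀''_of_ne`, `blockAbar''_of_ne`, `matAbarIota''_apply_of_ne`), the row itself
  (`blockAbar₀''_zero_two`, `blockAbar''_zero_two`, `blockAbar''_zero_two_eq`), translation invariance, the closed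
  form `matAbarIota''_zero_two : (Ā''^ι)_{0,2} = sup_y Σ_x Σ_κ 𝓣_{1,1̲,0}(−(x+y), e_κ−(x+y), −y)`, for bond
  percolation the comparison `Ā'' ≤ Ā'` (pointwise and entrywise, from `𝓣 ≤ 𝓣*`), and the four instances of the
  generic `x`-space → matrix transfer ((6.5), Lemma 5.3) on `(Ā''^ι)` (one-liners over `NobleBlocksPrime` §D, as its §E
  does for `(Ā'^ι)`).

The starred family is untouched: §5.1 Table (p. 47) keeps `𝓣*` for `b ≠ 0` ("the connections are not
repulsive"), and `blockAbarSt₀` reaches `(0,2)` through its non-repulsive wildcard row.  Discrepancy record: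
programme note D68 (App. B (B.5c) vs §6.1) — quoted here as the reason for the additive typing, not as a fact.
-/

noncomputable section

namespace Literature.Probability.FitznerVanDerHofstad2017.NobleBlocks

open Literature.Probability.LatticeModels Literature.Probability.Percolation
open Literature.Probability.FitznerVanDerHofstad2017.BlockSummation
open Literature.Barriers.CriticalPhenomena (nobleXiIotaN)
open scoped BigOperators ENNReal Matrix

variable {d : ℕ}

/-! ## A. The family -/

/-- `Ā''^{ι,a,b}(0,v,x,y)`: row `(0,2)` = `δ_{0,v} 𝓣_{1,1̲,0}(−y, e_ι−y, x−y)` (repulsive, §6.1), every other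
row = the primed table `blockAbar₀'`.
[cite: FitznerVanDerHofstad2017, §6.1 "Case a = 0, b ≥ 2" (arXiv:1506.07977v2 p. 59); App. B display "double-open triangle Ā^{ι,a,b}" row (0,2) (p. 78)] -/
def blockAbar₀'' (L : Letters d) (ι : Fin d × Bool) (a b : Fin 3) (v x y : Site d) : ℝ≥0∞ :=
  if a = 0 ∧ b = 2 then kd v 0 * L.T (.ge 1) (.eq 1) (.ge 0) (-y) (stepVec ι - y) (x - y)
  else blockAbar₀' L ι a b v x y

/-- `Ā''^{ι,a,b}(u,v,x,y)`. [cite: FitznerVanDerHofstad2017, §6.1 (arXiv:1506.07977v2 p. 59); (6.4) (p. 58); App. B (p. 78)] -/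
def blockAbar'' (L : Letters d) (ι : Fin d × Bool) (a b : Fin 3) : Site d → Site d → Site d → Site d → ℝ≥0∞ :=
  ofBase (blockAbar₀'' L ι a b)

/-- `(Ā''^ι)_{a,b}`. [cite: FitznerVanDerHofstad2017, §5.1 "Elements of the bounds" (arXiv:1506.07977v2 p. 49); §6.1 (p. 59)] -/
def matAbarIota'' (L : Letters d) : Matrix (Fin 3) (Fin 3) ℝ≥0∞ := matAbar (blockAbar'' L)

/-! ## B. Row `(0,2)` and agreement with the primed family off `(0,2)` -/

section Rows

variable (L : Letters d) (ι : Fin d × Bool)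

/-- The row `(0,2)` of the table. [cite: FitznerVanDerHofstad2017, §6.1 "Case a = 0, b ≥ 2" (arXiv:1506.07977v2 p. 59)] -/
theorem blockAbar₀''_zero_two (v x y : Site d) :
    blockAbar₀'' L ι 0 2 v x y = kd v 0 * L.T (.ge 1) (.eq 1) (.ge 0) (-y) (stepVec ι - y) (x - y) := by
  simp [blockAbar₀'']

/-- Off `(0,2)` the table is the primed one. [cite: FitznerVanDerHofstad2017, App. B (arXiv:1506.07977v2 p. 78)] -/
theorem blockAbar₀''_of_ne {a b : Fin 3} (h : ¬(a = 0 ∧ b = 2)) : blockAbar₀'' L ι a b = blockAbar₀' L ι a b := by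
  funext v x y; simp [blockAbar₀'', h]

/-- Off `(0,2)` the block is the primed one. [cite: FitznerVanDerHofstad2017, App. B (arXiv:1506.07977v2 p. 78)] -/
theorem blockAbar''_of_ne {a b : Fin 3} (h : ¬(a = 0 ∧ b = 2)) : blockAbar'' L ι a b = blockAbar' L ι a b := by
  rw [blockAbar'', blockAbar₀''_of_ne L ι h]; rfl

/-- The block at `(0,2)`: `δ_{w,u} 𝓣_{1,1̲,0}(u−z, u+e_ι−z, t−z)` (arguments `(u,w,t,z)`).
[cite: FitznerVanDerHofstad2017, §6.1 "Case a = 0, b ≥ 2" (arXiv:1506.07977v2 p. 59); (6.4) (p. 58)] -/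
theorem blockAbar''_zero_two (u w t z : Site d) :
    blockAbar'' L ι 0 2 u w t z =
      kd (w - u) 0 * L.T (.ge 1) (.eq 1) (.ge 0) (-(z - u)) (stepVec ι - (z - u)) (t - u - (z - u)) := by
  rw [blockAbar'', ofBase, blockAbar₀''_zero_two]

/-- The row `(0,2)` in the relevant configuration `w = u`, `v = u + e_ι`: `𝓣_{1,1̲,0}(u−z, v−z, t−z)`.
[cite: FitznerVanDerHofstad2017, §6.1 "Case a = 0, b ≥ 2" (arXiv:1506.07977v2 p. 59)] -/
theorem blockAbar''_zero_two_eq {u v : Site d} (hv : v = u + stepVec ι) (t z : Site d) :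
    blockAbar'' L ι 0 2 u u t z = L.T (.ge 1) (.eq 1) (.ge 0) (u - z) (v - z) (t - z) := by
  rw [blockAbar''_zero_two, sub_self, kd_self, one_mul, hv]
  congr 1 <;> abel

end Rows

/-- Off the entry `(0,2)` the double-primed `(Ā^ι)` is the primed one.
[cite: FitznerVanDerHofstad2017, App. B (arXiv:1506.07977v2 p. 78); §5.1 (p. 49)] -/
theorem matAbarIota''_apply_of_ne (L : Letters d) {a b : Fin 3} (h : ¬(a = 0 ∧ b = 2)) :
    matAbarIota'' L a b = matAbarIota' L a b := by
  simp only [matAbarIota'', matAbarIota', matAbar_apply, blockAbar''_of_ne L _ h]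

/-! ## C. Translation invariance -/

/-- [cite: FitznerVanDerHofstad2017, (6.4) (arXiv:1506.07977v2 p. 58)] -/
theorem isTransInv_blockAbar'' (L : Letters d) (ι : Fin d × Bool) (a b : Fin 3) :
    IsTransInv (blockAbar'' L ι a b) := isTransInv_ofBase _

/-! ## D. The closed form of the entry `(0,2)` -/

/-- `(Ā''^ι)_{0,2} = sup_y Σ_x Σ_κ 𝓣_{1,1̲,0}(−(x+y), e_κ−(x+y), −y)` (row `a = 0 ⇒ v = 0`; the supremum over the
out-gap survives) — the closed form of `NobleElementsClosedForms.matAbarIota_zero_two` with `𝓣` for `𝓣*`.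
[cite: FitznerVanDerHofstad2017, §6.1 "Case a = 0, b ≥ 2" (arXiv:1506.07977v2 p. 59); §5.1 "Elements of the bounds" (p. 49); (6.5) (p. 58)] -/
theorem matAbarIota''_zero_two (L : Letters d) : matAbarIota'' L 0 2 =
    ⨆ y, ∑' x, ∑ κ : Fin d × Bool, L.T (.ge 1) (.eq 1) (.ge 0) (-(x + y)) (stepVec κ - (x + y)) (-y) := by
  have h : ∀ κ v x y, blockAbar'' L κ 0 2 0 v x y =
      kd v 0 * L.T (.ge 1) (.eq 1) (.ge 0) (-y) (stepVec κ - y) (x - y) := fun κ v x y => by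
    rw [blockAbar'', ofBase_zero, blockAbar₀''_zero_two]
  rw [matAbarIota'', matAbar_apply,
    iSup_eq_apply_zero (fun v => ⨆ y, ∑' x, ∑ κ, blockAbar'' L κ 0 2 0 v x (x + y)) fun v hv => by
      simp [h, kd_of_ne hv]]
  simp only [h, kd_self, one_mul, sub_add_cancel_left]

/-! ## E. Bond percolation: `Ā'' ≤ Ā'` (from `𝓣 ≤ 𝓣*`) -/

section Perc

variable (p : unitInterval)

/-- Pointwise `Ā''^{ι,a,b} ≤ Ā'^{ι,a,b}` for the percolation letters (equality off `(0,2)`; at `(0,2)` it is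
`𝓣_{1,1̲,0} ≤ 𝓣*_{1,1̲,0}`). [cite: FitznerVanDerHofstad2017, §4.2 (4.14)–(4.15) (arXiv:1506.07977v2 pp. 35–36); App. B (p. 78); §6.1 (p. 59)] -/
theorem perc_blockAbar''_le_blockAbar' (ι : Fin d × Bool) (a b : Fin 3) (u w t z : Site d) :
    blockAbar'' (Letters.perc d p) ι a b u w t z ≤ blockAbar' (Letters.perc d p) ι a b u w t z := by
  by_cases h : a = 0 ∧ b = 2
  · obtain ⟨rfl, rfl⟩ := h
    rw [blockAbar''_zero_two, blockAbar'_of_ne _ ι (by decide)]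
    show _ ≤ kd (w - u) 0 * (Letters.perc d p).Tst (.ge 1) (.eq 1) (.ge 0) (-(z - u)) (stepVec ι - (z - u))
      (t - u - (z - u))
    gcongr
    exact perc_T_le_Tst p _ _ _ _ _ _
  · rw [blockAbar''_of_ne _ ι h]

/-- Entrywise `(Ā''^ι)_{a,b} ≤ (Ā'^ι)_{a,b}` for the percolation letters.
[cite: FitznerVanDerHofstad2017, §4.2 (4.14)–(4.15) (arXiv:1506.07977v2 pp. 35–36); §5.1 (p. 49)] -/
theorem perc_matAbarIota''_le_matAbarIota' (a b : Fin 3) :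
    matAbarIota'' (Letters.perc d p) a b ≤ matAbarIota' (Letters.perc d p) a b := by
  rw [matAbarIota'', matAbarIota', matAbar_apply, matAbar_apply]
  exact iSup_mono fun v => iSup_mono fun y => ENNReal.tsum_le_tsum fun x =>
    Finset.sum_le_sum fun κ _ => perc_blockAbar''_le_blockAbar' p κ a b _ _ _ _

end Perc

/-! ## F. Instances of the `x`-space → matrix transfer on `(Ā''^ι) = matAbarIota'' L` -/

/-- **(6.5) on the doubly-primed element**: `Σ_x Ξ(x) ≤ P⃗^S (Ā''^ι) P⃗^E` from the `x`-space bound (6.4) written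
with `blockAbar''`. [cite: FitznerVanDerHofstad2017, Lemma 5.2 first display, §6.1 (6.4)–(6.5) (arXiv:1506.07977v2 pp. 50, 58)] -/
theorem tsum_le_vecPS_matAbarIota''_vecPE (L : Letters d) (Ξ : Site d → ℝ≥0∞)
    (hΞ : ∀ x, Ξ x ≤ ∑' u, ∑' w, ∑' t, ∑' z, ∑ ι : Fin d × Bool, ∑ a : Fin 3, ∑ b : Fin 3,
      blockPS L a u w * blockAbar'' L ι a b u w t z * blockPE L b (t - x) (z - x)) :
    ∑' x, Ξ x ≤ vecPS L ᵥ* matAbarIota'' L ⬝ᵥ vecPE L :=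
  tsum_le_vecP_vecMul_matAbar_dotProduct_vecPE L (isTransInv_blockAbar'' L) (blockPS L) Ξ hΞ

/-- **Lemma 5.3 first display on the doubly-primed element, fixed direction, no trivial term**:
`Σ_x Ξ(x) ≤ vecP (P^{ι₀,·}) ᵛ* (Ā''^ι) ⬝ P⃗^E`. [cite: FitznerVanDerHofstad2017, Lemma 5.3 first display (arXiv:1506.07977v2 p. 50); §6.1 (p. 59)] -/
theorem tsum_le_vecPiota_matAbarIota''_vecPE (L : Letters d) (ι₀ : Fin d × Bool) (Ξ : Site d → ℝ≥0∞)
    (hΞ : ∀ x, Ξ x ≤ ∑' u, ∑' w, ∑' t, ∑' z, ∑ ι : Fin d × Bool, ∑ a : Fin 3, ∑ b : Fin 3,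
      blockPiota L ι₀ a u w * blockAbar'' L ι a b u w t z * blockPE L b (t - x) (z - x)) :
    ∑' x, Ξ x ≤ vecP (blockPiota L ι₀) ᵥ* matAbarIota'' L ⬝ᵥ vecPE L :=
  tsum_le_vecP_vecMul_matAbar_dotProduct_vecPE L (isTransInv_blockAbar'' L) (blockPiota L ι₀) Ξ hΞ

/-- **(BoundXiIotaOne-1) on the doubly-primed element, `ι`-averaged with the trivial term**:
`(1/2d) Σ_ι Σ_x Ξ^ι(x) ≤ P⃗^ι (Ā''^ι) P⃗^E`. [cite: FitznerVanDerHofstad2017, Lemma 5.3 (BoundXiIotaOne-1) (arXiv:1506.07977v2 p. 50); §6.1 (p. 59)] -/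
theorem invTwoD_mul_sum_tsum_le_vecPiota_matAbarIota''_vecPE (L : Letters d)
    (Ξι : Fin d × Bool → Site d → ℝ≥0∞)
    (hΞ : ∀ ι x, Ξι ι x ≤ ∑' u, ∑' w, ∑' t, ∑' z, ∑ κ : Fin d × Bool, ∑ a : Fin 3, ∑ b : Fin 3,
      (kdeltaPref ι κ a u w + blockPiota L ι a u w) * blockAbar'' L κ a b u w t z * blockPE L b (t - x) (z - x)) :
    invTwoD d * ∑ ι : Fin d × Bool, ∑' x, Ξι ι x ≤ vecPiota L ᵥ* matAbarIota'' L ⬝ᵥ vecPE L :=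
  invTwoD_mul_sum_tsum_le_vecPiota_matAbar_vecPE L (isTransInv_blockAbar'' L) Ξι hΞ

/-- **(BoundXiIotaOne-1) for `Ξ^{(N),ι}_p` on the doubly-primed element**: if `Ξ^{(N),ι}_p` obeys (6.x) with
`blockAbar''` for every `ι`, then `Σ_x Ξ^{(N),ι₀}_p(x) ≤ P⃗^ι (Ā''^ι) P⃗^E` for every `ι₀`.
[cite: FitznerVanDerHofstad2017, Lemma 5.3 (BoundXiIotaOne-1) (arXiv:1506.07977v2 p. 50); §6.1 (p. 59); §3.5 (p. 30)] -/
theorem tsum_ofReal_nobleXiIotaN_le_vecPiota_matAbarIota''_vecPE (L : Letters d) (p : unitInterval) (N : ℕ)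
    (hΞ : ∀ ι x, ENNReal.ofReal (nobleXiIotaN d p (stepVec ι) N x)
      ≤ ∑' u, ∑' w, ∑' t, ∑' z, ∑ κ : Fin d × Bool, ∑ a : Fin 3, ∑ b : Fin 3,
        (kdeltaPref ι κ a u w + blockPiota L ι a u w) * blockAbar'' L κ a b u w t z * blockPE L b (t - x) (z - x))
    (ι₀ : Fin d × Bool) :
    ∑' x, ENNReal.ofReal (nobleXiIotaN d p (stepVec ι₀) N x) ≤ vecPiota L ᵥ* matAbarIota'' L ⬝ᵥ vecPE L :=
  tsum_ofReal_nobleXiIotaN_le_vecPiota_matAbar_vecPE L (isTransInv_blockAbar'' L) p N hΞ ι₀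

end Literature.Probability.FitznerVanDerHofstad2017.NobleBlocks
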